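import Literature.Computability.Complexity.HonestTableLDE
import HarnessLib

/-!
# The honest sumcheck messages of the scaled PCP, in polynomial time in the padded length

Literature / complexity toolkit, machine-layer brick of the probabilistically checkable proofs for
exponential-time computations (Babai–Fortnow–Lund 1991 / Babai–Fortnow–Levin–Szegedy 1991): the
PROVER's side, second half (after `HonestTableLDE.lean`, the honest oracle `Ŷ`). The honest message
of the sumcheck (`SumcheckField.roundPoly`) for the summand
`Φ(z) = (∑_φ λ^φ P_φ(z, Ŷ ∘ addr_φ(z))) · ∏ₜ EQ_H(zₜ, ρₜ)` (`AlgebraicPCP.Φ`) after the challenge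
prefix `r₁ … rᵢ` is the polynomial `g(X) = ∑_{c ∈ H^{K-i-1}} Φ(r, X, c)` of degree `≤ D`; the proof
table stores its `D + 1` COEFFICIENTS. This file computes them with residues — evaluate `g` at the
nodes `0, …, D` by brute-force summation over `H^{K-i-1}` (enumerated by base-`h` digits) and
interpolate (Lagrange over `{0, …, D} ⊆ 𝔽_p`, `D + 1 ≤ p`) — and proves the computation correct and
polynomial time in its (exponentially padded) input:

* `coeff_eq_sum_lagrange` — a polynomial of degree `≤ D` over `ZMod p`, `D + 1 ≤ p`, has
  `coeff j = ∑_{a ≤ D} g(a) · [Xʲ] L_a` (`Lagrange.eq_interpolate`); `polyMulLinN` /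
  `lagrNumCoeffsN` / **`lagrCoeffsN`** — the coefficient list of `L_a` as residues
  (`cast_lagrCoeffsN`); `psum_eq_sum_digits` — the partial sums of `SumcheckField` over `Hᵏ`,
  `H = {0, …, h-1}`, as sums over `i < hᵏ` of the digit vectors;
* the semantics `readsN` (the oracle values at the read addresses, `YhN ∘ addrN`), `kernelN`
  (`∏ₜ EQ_H(zₜ, ρₜ)`), **`PhiN`**, **`psumN`** (budgeted enumeration), **`msgCoeffsN`**, with the
  bridges `cast_kernelN`, **`cast_PhiN`** (`= AlgebraicPCP.Φ` of the honest oracle of the tableau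
  CSP), **`cast_psumN`** (`= SumcheckField.psum`), **`cast_msgCoeffsN`**
  (`= (roundPoly H hΦ pref).coeff j`, the stored honest message, for `|pref| < K`);
* the programmes `foldlResList` (folds with a list of residues as accumulator), `polyMulLinC`,
  `lagrCoeffsC`, `readsNC`, `kernelNC`, `PhiNC`, `psumNC`, **`msgCoeffsC`** over the prover's
  context record `PCtx` (`pcE`: the evaluation parameters `Prm`, the unary `K`, `D` and budgets
  `1^{T+1}`, `1^{S₁+1}`, `1^{N}` with `N ≥ hᴷ`, the input `(x, u)`, the descriptor list).

All proved; no machine beyond the typed combinators; no named fact.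

## References

* L. Babai, L. Fortnow, C. Lund, *Non-deterministic exponential time has two-prover interactive
  protocols*, Comput. Complexity 1 (1991), §5 (the honest prover's messages are the partial sums;
  exponential-time provers) [BabaiFortnowLund1991].
* L. Babai, L. Fortnow, L. Levin, M. Szegedy, *Checking computations in polylogarithmic time*,
  STOC 1991, §5 [BFLS1991].
* S. Arora, B. Barak, *Computational Complexity: A Modern Approach*, CUP 2009, §8.3.2 (the honest
  sumcheck prover), §1.3 [AroraBarakCC2009].
-/

noncomputable section

open Finset Polynomial

namespace Literature.Computability.Complexity

namespace TabEval

open ModArith CodeFP Turing Tableau TableauCSP DigitPoly LowDegreeExtension AlgebraicPCP SumcheckF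

attribute [local instance] Turing.FinTM2.kFin Turing.FinTM2.ΛFin Turing.FinTM2.σFin
  Turing.FinTM2.Γk₀Fin

/-! ### Interpolation on the nodes `{0, …, D}` -/

section Interp

variable {p : ℕ} [hp : Fact p.Prime]

/-- The nodes `{0, …, N-1}` of `ZMod p` have `N` elements for `N ≤ p`. [folklore] -/
theorem card_nodes {N : ℕ} (hN : N ≤ p) : (DigitPoly.nodes (F := ZMod p) N).card = N := by
  unfold DigitPoly.nodes
  rw [card_image_of_injOn fun a ha b hb e => ?_, card_range]
  exact (natCast_ne_natCast (lt_of_lt_of_le (mem_range.1 (mem_coe.1 ha)) hN) (lt_of_lt_of_le (mem_range.1 (mem_coe.1 hb)) hN)).mtr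
    (by simpa using e)

/-- **Coefficients by interpolation**: a polynomial of degree `≤ D` over `ZMod p` with `D + 1 ≤ p`
satisfies `[Xʲ] g = ∑_{a ≤ D} g(a) · [Xʲ] L_a` (`L_a` the Lagrange basis of `{0, …, D}`).
[cite: AroraBarakCC2009, §A.6 (Lagrange interpolation)] -/
theorem coeff_eq_sum_lagrange {D : ℕ} (hD : D + 1 ≤ p) {g : (ZMod p)[X]} (hg : g.natDegree ≤ D) (j : ℕ) :
    g.coeff j = ∑ a ∈ range (D + 1), g.eval (a : ZMod p) * (Lagrange.basis (DigitPoly.nodes (F := ZMod p) (D + 1)) id (a : ZMod p)).coeff j := by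
  have hinj : Set.InjOn (id : ZMod p → ZMod p) (DigitPoly.nodes (F := ZMod p) (D + 1)) := fun _ _ _ _ h => h
  have hdeg : g.degree < (DigitPoly.nodes (F := ZMod p) (D + 1)).card := by
    rw [card_nodes hD]
    exact lt_of_le_of_lt (degree_le_of_natDegree_le hg) (by exact_mod_cast Nat.lt_succ_self D)
  have h := Lagrange.eq_interpolate hinj hdeg
  conv_lhs => rw [h]
  rw [Lagrange.interpolate_apply, finsetSum_coeff]
  unfold DigitPoly.nodes
  rw [sum_image fun a ha b hb e => ?_]
  · refine sum_congr rfl fun a _ => ?_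
    rw [coeff_C_mul, id]
  · exact (natCast_ne_natCast (lt_of_lt_of_le (mem_range.1 (mem_coe.1 ha)) hD) (lt_of_lt_of_le (mem_range.1 (mem_coe.1 hb)) hD)).mtr
      (by simpa using e)

/-! ### The Lagrange basis coefficients as residues -/

/-- A coefficient list REPRESENTS a polynomial: every coefficient is the cast of the listed residue
(`0` beyond the list). [folklore] -/
def Represents (p : ℕ) (cs : List ℕ) (Q : (ZMod p)[X]) : Prop := ∀ j : ℕ, Q.coeff j = ((cs.getD j 0 : ℕ) : ZMod p)

/-- Multiplying a coefficient list by `X - b`: `c'ⱼ = c_{j-1} - b cⱼ`. [folklore] -/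
def polyMulLinN (p : ℕ) (cs : List ℕ) (b : ℕ) : List ℕ :=
  List.zipWith (fun u v => subM p u (mulM p b v)) (0 :: cs) (cs ++ [0])

omit hp in
/-- Length of the product list. [folklore] -/
@[simp] theorem length_polyMulLinN (cs : List ℕ) (b : ℕ) : (polyMulLinN p cs b).length = cs.length + 1 := by
  simp [polyMulLinN]

/-- `getD` of the shifted list `0 :: cs`. [folklore] -/
theorem getD_zero_cons_succ (cs : List ℕ) (j : ℕ) : (0 :: cs).getD (j + 1) 0 = cs.getD j 0 := rfl

omit hp in
/-- `getD` of `cs ++ [0]` is `getD` of `cs`. [folklore] -/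
theorem getD_append_zero (cs : List ℕ) (j : ℕ) : (cs ++ [0]).getD j 0 = cs.getD j 0 := by
  rw [List.getD_eq_getElem?_getD, List.getD_eq_getElem?_getD]
  rcases lt_or_ge j cs.length with hj | hj
  · rw [List.getElem?_append_left hj]
  · rw [List.getElem?_append_right hj, List.getElem?_eq_none (by omega : cs.length ≤ j)]
    rcases Nat.lt_or_ge (j - cs.length) 1 with h1 | h1
    · rw [show j - cs.length = 0 by omega]; rfl
    · rw [List.getElem?_eq_none (by simpa using h1)]

omit hp in
/-- An entry of `polyMulLinN`. [folklore] -/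
theorem getD_polyMulLinN (cs : List ℕ) (b j : ℕ) :
    (polyMulLinN p cs b).getD j 0 = if j < cs.length + 1 then subM p ((0 :: cs).getD j 0) (mulM p b (cs.getD j 0)) else 0 := by
  unfold polyMulLinN
  split_ifs with hj
  · rw [List.getD_eq_getElem _ _ (by simpa using hj), List.getElem_zipWith, List.getD_eq_getElem _ _ (by simpa using hj),
      ← getD_append_zero cs j, List.getD_eq_getElem _ _ (by simpa using hj)]
  · exact List.getD_eq_default _ _ (by simpa using hj)

/-- **`polyMulLinN` multiplies by `X - b`.** [folklore] -/
theorem represents_polyMulLinN {cs : List ℕ} {Q : (ZMod p)[X]} (h : Represents p cs Q) (b : ℕ) :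
    Represents p (polyMulLinN p cs b) ((X - C (b : ZMod p)) * Q) := by
  intro j
  rw [sub_mul, coeff_sub, coeff_C_mul, getD_polyMulLinN]
  have hQ : ∀ i, cs.length ≤ i → Q.coeff i = 0 := fun i hi => by rw [h i, List.getD_eq_default _ _ hi, Nat.cast_zero]
  cases j with
  | zero =>
    rw [coeff_X_mul_zero, h 0]
    split_ifs with hj
    · rw [natCast_subM, natCast_mulM]; simp
    · omega
  | succ j =>
    rw [coeff_X_mul, h j, h (j + 1)]
    split_ifs with hj
    · rw [natCast_subM, natCast_mulM, getD_zero_cons_succ]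
    · rw [List.getD_eq_default _ _ (by omega), List.getD_eq_default _ _ (by omega)]
      simp

/-- **The numerator coefficients** of the Lagrange basis polynomial of node `a` among `{0,…,N-1}`:
the coefficient list of `∏_{b < N, b ≠ a} (X - b)`, by repeated multiplication. [folklore] -/
def lagrNumCoeffsN (p N a : ℕ) : List ℕ := ((List.range N).filter (· ≠ a)).foldl (polyMulLinN p) [1 % p]

/-- **The coefficients of the Lagrange basis polynomial** `L_a` of `{0, …, N-1}` (numerator over the
denominator `∏_{b ≠ a} (a - b)`). [cite: AroraBarakCC2009, §A.6] -/
def lagrCoeffsN (p N a : ℕ) : List ℕ := (lagrNumCoeffsN p N a).map fun c => mulM p (invM p (lagrDenM p N a)) c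

/-- The fold represents the product. [folklore] -/
theorem represents_foldl_polyMulLinN (l : List ℕ) :
    ∀ {cs : List ℕ} {Q : (ZMod p)[X]}, Represents p cs Q →
      Represents p (l.foldl (polyMulLinN p) cs) ((l.map fun b : ℕ => X - C (b : ZMod p)).prod * Q) := by
  induction l with
  | nil => intro cs Q h; simpa using h
  | cons b l ih =>
    intro cs Q h
    rw [List.foldl_cons, List.map_cons, List.prod_cons, mul_comm (X - C (b : ZMod p)), mul_assoc]
    exact ih (represents_polyMulLinN h b)

/-- `[1 % p]` represents `1`. [folklore] -/
theorem represents_one : Represents p [1 % p] (1 : (ZMod p)[X]) := by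
  intro j
  cases j with
  | zero => simp
  | succ j => simp [Polynomial.coeff_one]

/-- **The numerator list represents `∏_{b ∈ {0,…,N-1} ∖ {a}} (X - b)`.** [folklore] -/
theorem represents_lagrNumCoeffsN (N a : ℕ) :
    Represents p (lagrNumCoeffsN p N a) (∏ b ∈ (range N).erase a, (X - C (b : ZMod p))) := by
  have h := represents_foldl_polyMulLinN (p := p) ((List.range N).filter (· ≠ a)) represents_one
  rw [mul_one] at h
  have hl : (((List.range N).filter (· ≠ a)).map fun b : ℕ => X - C (b : ZMod p)).prod = ∏ b ∈ (range N).erase a, (X - C (b : ZMod p)) := by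
    rw [← List.prod_toFinset _ ((List.nodup_range).filter _), List.toFinset_filter, List.toFinset_range]
    refine prod_congr (Finset.ext fun b => ?_) fun _ _ => rfl
    simp [mem_filter, mem_erase, and_comm]
  rw [hl] at h
  exact h

/-- **The Lagrange basis polynomial through its numerator**: for `a < N ≤ p`,
`L_a = C (∏_{b ≠ a} (a - b))⁻¹ · ∏_{b ≠ a} (X - b)` over the nodes `{0, …, N-1}` of `ZMod p`.
[Mathlib `Lagrange.basis`] [folklore] -/
theorem lagrange_basis_eq {N a : ℕ} (hN : N ≤ p) (ha : a < N) :
    Lagrange.basis (DigitPoly.nodes (F := ZMod p) N) id (a : ZMod p) =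
      C ((lagrDenM p N a : ℕ) : ZMod p)⁻¹ * ∏ b ∈ (range N).erase a, (X - C (b : ZMod p)) := by
  unfold Lagrange.basis
  rw [show DigitPoly.nodes (F := ZMod p) N = ModArith.nodes p N from rfl, nodes_erase hN ha, prod_image fun b hb c hc e => ?_]
  · simp only [Lagrange.basisDivisor, id]
    rw [prod_mul_distrib, ← map_prod C, prod_inv_distrib, lagrDenM, natCast_lagrNumM]
  · exact (natCast_ne_natCast (lt_of_lt_of_le (mem_range.1 (mem_of_mem_erase hb)) hN)
      (lt_of_lt_of_le (mem_range.1 (mem_of_mem_erase hc)) hN)).mtr (by simpa using e)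

/-- **The coefficient list of the Lagrange basis polynomial.** For `a < N ≤ p`:
`((lagrCoeffsN p N a).getD j 0 : ZMod p) = [Xʲ] L_a`. [cite: AroraBarakCC2009, §A.6] -/
theorem cast_lagrCoeffsN {N a : ℕ} (hN : N ≤ p) (ha : a < N) (j : ℕ) :
    (((lagrCoeffsN p N a).getD j 0 : ℕ) : ZMod p) = (Lagrange.basis (DigitPoly.nodes (F := ZMod p) N) id (a : ZMod p)).coeff j := by
  have hden : ((lagrDenM p N a : ℕ) : ZMod p) ≠ 0 := natCast_lagrDenM_ne_zero hN ha
  have h0 : (0 : ℕ) = mulM p (invM p (lagrDenM p N a)) 0 := by simp [mulM]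
  rw [lagrCoeffsN, h0, List.getD_map, natCast_mulM, natCast_invM _ (Or.inl hden), ← represents_lagrNumCoeffsN N a j,
    lagrange_basis_eq hN ha, coeff_C_mul]

end Interp

/-! ### Partial sums over `Hᵏ` as sums over digit vectors -/

section Digits

variable {p : ℕ} [hp : Fact p.Prime]

/-- The nodes `{0, …, h-1}` in bijection with `Fin h` (for `h ≤ p`). [folklore] -/
def finNodes {h : ℕ} (hh : h ≤ p) : Fin h ≃ (DigitPoly.nodes (F := ZMod p) h) :=
  Equiv.ofBijective (fun a => ⟨(a : ℕ), cast_mem_nodes a.2⟩) (by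
    constructor
    · intro a b e
      have e' : ((a : ℕ) : ZMod p) = ((b : ℕ) : ZMod p) := congrArg Subtype.val e
      exact Fin.ext ((natCast_ne_natCast (a.2.trans_le hh) (b.2.trans_le hh)).mtr e')
    · intro ⟨y, hy⟩
      obtain ⟨a, ha, rfl⟩ := mem_image.1 hy
      exact ⟨⟨a, mem_range.1 ha⟩, rfl⟩)

/-- **The partial sums of the sumcheck over `Hᵏ`, `H = {0, …, h-1}`, as sums over `i < hᵏ`** of
the base-`h` digit vectors of `i`. [cite: AroraBarakCC2009, §8.3.2] -/
theorem psum_eq_sum_digits {h : ℕ} (hh : h ≤ p) (Φ : List (ZMod p) → ZMod p) (K : ℕ) (l : List (ZMod p)) :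
    psum (DigitPoly.nodes (F := ZMod p) h) Φ K l =
      ∑ i ∈ range (h ^ (K - l.length)), Φ (l ++ (constDigits h (K - l.length) i).map (Nat.cast : ℕ → ZMod p)) := by
  set k := K - l.length
  unfold psum
  rw [cubeSum_eq_sum]
  -- reindex `Fin k → H` by `Fin (h^k)`
  let E : Fin (h ^ k) ≃ (Fin k → DigitPoly.nodes (F := ZMod p) h) :=
    finFunctionFinEquiv.symm.trans (Equiv.piCongrRight fun _ => finNodes hh)
  have hE : ∀ i : Fin (h ^ k), (List.ofFn fun t => ((E i t : DigitPoly.nodes (F := ZMod p) h) : ZMod p)) =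
      (constDigits h k i).map (Nat.cast : ℕ → ZMod p) := by
    intro i
    unfold constDigits
    rw [List.map_map, ← List.map_coe_finRange_eq_range, List.map_map, List.ofFn_eq_map]
    refine List.map_congr_left fun t _ => ?_
    simp [E, finNodes, finFunctionFinEquiv_symm_apply_val]
  set G' : ℕ → ZMod p := fun i => Φ (l ++ (constDigits h k i).map (Nat.cast : ℕ → ZMod p))
  calc ∑ c : Fin k → DigitPoly.nodes (F := ZMod p) h, Φ (l ++ List.ofFn fun t => ((c t : DigitPoly.nodes (F := ZMod p) h) : ZMod p))
      = ∑ i : Fin (h ^ k), Φ (l ++ List.ofFn fun t => ((E i t : DigitPoly.nodes (F := ZMod p) h) : ZMod p)) :=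
        (Fintype.sum_equiv E _ _ fun i => rfl).symm
    _ = ∑ i : Fin (h ^ k), G' i := Fintype.sum_congr _ _ fun i => by rw [hE]
    _ = ∑ i ∈ range (h ^ k), G' i := Fin.sum_univ_eq_sum_range G' _

end Digits

/-! ### The kernel `∏ₜ EQ_H(zₜ, ρₜ)` -/

section Kernel

variable {p : ℕ} [hp : Fact p.Prime]

/-- **`eqPolyM` is the kernel `EQ_H`** of `AlgebraicPCP` on `H = {0, …, h-1}` (`h ≤ p`). [cite: BabaiFortnowLund1991, §4] -/
theorem cast_eqPolyM {h : ℕ} (hh : h ≤ p) (a b : ℕ) :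
    ((eqPolyM p h a b : ℕ) : ZMod p) = eqPoly (DigitPoly.nodes (F := ZMod p) h) (a : ZMod p) (b : ZMod p) := by
  rw [natCast_eqPolyM, eqPoly]
  unfold DigitPoly.nodes
  rw [sum_image fun e he e' he' eq => ?_]
  · refine sum_congr rfl fun e he => ?_
    rw [natCast_lagrM hh (mem_range.1 he), natCast_lagrM hh (mem_range.1 he)]
    rfl
  · exact (natCast_ne_natCast (lt_of_lt_of_le (mem_range.1 (mem_coe.1 he)) hh) (lt_of_lt_of_le (mem_range.1 (mem_coe.1 he')) hh)).mtr
      (by simpa using eq)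

/-- `∏ₜ EQ_H(zₜ, ρₜ) mod p` on residue lists. [cite: BFLS1991, §5] -/
def kernelN (p h : ℕ) (zl ρl : List ℕ) : ℕ := prodM p ((zl.zip ρl).map fun ab => eqPolyM p h ab.1 ab.2)

/-- **The kernel on residue lists is the product of the kernels.** [cite: BFLS1991, §5] -/
theorem cast_kernelN {h : ℕ} (hh : h ≤ p) {K : ℕ} {zl : List ℕ} (hlen : zl.length = K) (ρ : Fin K → ZMod p) :
    ((kernelN p h zl (List.ofFn fun t => (ρ t).val) : ℕ) : ZMod p) =
      ∏ t : Fin K, eqPoly (DigitPoly.nodes (F := ZMod p) h) ((zl.getD (t : ℕ) 0 : ℕ) : ZMod p) (ρ t) := by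
  rw [kernelN, natCast_prodM, List.map_map]
  have hz : ((zl.zip (List.ofFn fun t => (ρ t).val)).map ((Nat.cast : ℕ → ZMod p) ∘ fun ab => eqPolyM p h ab.1 ab.2)) =
      List.ofFn fun t : Fin K => eqPoly (DigitPoly.nodes (F := ZMod p) h) ((zl.getD (t : ℕ) 0 : ℕ) : ZMod p) (ρ t) := by
    apply List.ext_getElem
    · simp [hlen]
    · intro i h1 h2
      rw [List.length_ofFn] at h2
      rw [List.getElem_map, List.getElem_ofFn]
      simp only [Function.comp_apply, List.getElem_zip, List.getElem_ofFn]
      rw [cast_eqPolyM hh, ZMod.natCast_zmod_val, List.getD_eq_getElem _ _ (by omega)]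
  rw [hz, List.prod_ofFn]

end Kernel

/-! ### The prover's context and the semantics of the messages -/

section Sem2

variable (M : TM2ComputableAux Bool Bool)

/-- **The prover's context**: the evaluation parameters, the index arity `K`, the message degree
`D`, the unary budgets `TB = T + 1`, `SB = S₁ + 1`, `NB ≥ hᴷ`, the input pair `(x, u)` and the
descriptor list of the CSP. [folklore] -/
structure PCtx where
  /-- evaluation parameters `(q, h, kt, kJ, n, P, T)` -/
  π : Prm
  /-- index arity -/
  K : ℕ
  /-- message degree bound -/
  D : ℕ
  /-- row budget `T + 1` -/
  TB : ℕ
  /-- column budget `S₁ + 1` -/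
  SB : ℕ
  /-- enumeration budget `≥ hᴷ` -/
  NB : ℕ
  /-- the input -/
  x : List Bool
  /-- the certificate -/
  u : List Bool
  /-- the descriptors of the constraint families -/
  fds : List FamDesc

/-- The `m` residues of a point given by a (possibly short or unreduced) list. [folklore] -/
def ptN (q m : ℕ) (al : List ℕ) : List ℕ := (List.range m).map fun u => al.getD u 0 % q

/-- **The oracle values at the read addresses** of all described families at the index `zl`.
[cite: BabaiFortnowLund1991, §5] -/
def PCtx.readsN (c : PCtx) (zl : List ℕ) : List (List ℕ) :=
  c.fds.map fun fd => fd.2.1.map fun rd =>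
    YhN M c.π.q c.π.h c.π.kt c.π.kJ c.x c.u c.TB c.SB (ptN c.π.q (c.π.kt + c.π.kJ + 1) (addrN c.π.h c.π.kt c.π.kJ zl rd))

/-- **The sumcheck summand** `Φ(z) = Ψ_λ(z) · ∏ₜ EQ_H(zₜ, ρₜ)` with residues. [cite: BFLS1991, §5] -/
def PCtx.PhiN (c : PCtx) (dd : ℕ) (ρl : List ℕ) (seed : ℕ) (zl : List ℕ) : ℕ :=
  mulM c.π.q (psiN c.π.q c.π.h c.π.kt c.π.kJ dd c.π.n c.π.P c.π.T seed zl (c.readsN M zl) c.fds) (kernelN c.π.q c.π.h zl ρl)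

/-- **The partial sum** `∑_{c ∈ H^{K-|l|}} Φ(l, c)` by enumeration of the digit vectors (budgeted by
`NB`). [cite: AroraBarakCC2009, §8.3.2] -/
def PCtx.psumN (c : PCtx) (dd : ℕ) (ρl : List ℕ) (seed : ℕ) (l : List ℕ) : ℕ :=
  sumM c.π.q ((List.range (min (c.π.h ^ (c.K - l.length)) c.NB)).map fun i =>
    c.PhiN M dd ρl seed (l ++ constDigits c.π.h (c.K - l.length) i))

/-- **The coefficients of the honest message** after the prefix `pref`: interpolation of the values
`psum (pref, a)`, `a = 0, …, D`. [cite: AroraBarakCC2009, §8.3.2] -/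
def PCtx.msgCoeffsN (c : PCtx) (dd : ℕ) (ρl : List ℕ) (seed : ℕ) (pref : List ℕ) : List ℕ :=
  (List.range (c.D + 1)).map fun j => sumM c.π.q ((List.range (c.D + 1)).map fun a =>
    mulM c.π.q (c.psumN M dd ρl seed (pref ++ [a])) ((lagrCoeffsN c.π.q (c.D + 1) a).getD j 0))

/-- The honest oracle value is a reduced residue. [folklore] -/
theorem YhN_lt {q : ℕ} (hq : 0 < q) (h kt kJ : ℕ) (x u : List Bool) (TB SB : ℕ) (w : List ℕ) :
    YhN M q h kt kJ x u TB SB w < q := by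
  unfold YhN; rw [sumM_eq]; exact Nat.mod_lt _ hq

/-! ### Bridges -/

variable {M} {p : ℕ} [hp : Fact p.Prime] (L : Layout) {x u : List Bool} {P T D NB : ℕ}

local notation "d" => dM M

/-- **The actual context** of the prover for `M`, layout `L`, input `⟨x, u⟩`, bounds `P`, `T`,
degree `D`, budget `NB`, over `ZMod p`. [folklore] -/
def actx (p : ℕ) (M : TM2ComputableAux Bool Bool) (L : Layout) (x u : List Bool) (P T D NB : ℕ) : PCtx :=
  ⟨⟨p, L.h, L.kt, L.kJ, x.length, P, T⟩, KIdx L (dM M), D, T + 1, S1 M x.length P T + 1, NB, x, u, descs M x.length P T x⟩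

/-- `getD` through the cast of a residue list. [folklore] -/
theorem getD_map_cast (l : List ℕ) (t : ℕ) : (l.map (Nat.cast : ℕ → ZMod p)).getD t 0 = ((l.getD t 0 : ℕ) : ZMod p) := by
  rw [List.getD_eq_getElem?_getD, List.getElem?_map, List.getD_eq_getElem?_getD]
  cases l[t]? <;> simp

/-- The residues of a point function, recovered. [folklore] -/
theorem ofFn_val_eq_ptN {m : ℕ} (al : List ℕ) :
    (List.ofFn fun s : Fin m => ((((al.getD (s : ℕ) 0 : ℕ) : ZMod p)).val)) = ptN p m al := by
  unfold ptN
  rw [List.ofFn_eq_map, ← List.map_coe_finRange_eq_range, List.map_map]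
  refine List.map_congr_left fun s _ => ?_
  simp [ZMod.val_natCast]

/-- The residues of an index given by a reduced residue list. [folklore] -/
theorem zlOf_cast {K' : ℕ} (hK : K' = KIdx L d) (lN : List ℕ) (hlen : lN.length = K') (hlt : ∀ a ∈ lN, a < p) :
    zlOf M L (fun t : Fin (KIdx L d) => ((lN.getD (t : ℕ) 0 : ℕ) : ZMod p)) = lN := by
  subst hK
  unfold zlOf
  apply List.ext_getElem
  · simp [hlen]
  · intro i h1 h2
    rw [List.getElem_ofFn]
    dsimp only
    rw [List.getD_eq_getElem _ _ h2, ZMod.val_natCast, Nat.mod_eq_of_lt (hlt _ (List.getElem_mem h2))]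

variable (hh : L.h ≤ p) (hval : Nat.card (Val M.tm) ≤ L.h) (hT : T < L.h ^ L.kt) (hS : S1 M x.length P T < L.h ^ L.kJ)
include hh hval hT hS

/-- **The summand with residues is the summand of the analysis** for the honest oracle of the tableau
CSP: for a residue list `lN` of length `K` with entries `< p`,
`(PhiN … ρ seed lN : ZMod p) = Φ_H(C, Ŷ, ρ, λ)(lN)`. [cite: BFLS1991, §5] -/
theorem cast_PhiN (ρ : Fin (KIdx L d) → ZMod p) (seed : ZMod p) (lN : List ℕ) (hlen : lN.length = KIdx L d)
    (hlt : ∀ a ∈ lN, a < p) :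
    (((actx p M L x u P T D NB).PhiN M d (List.ofFn fun t => (ρ t).val) seed.val lN : ℕ) : ZMod p) =
      Φ (DigitPoly.nodes (F := ZMod p) L.h) (tableauCSP (F := ZMod p) M L P T x)
        (lde (DigitPoly.nodes (F := ZMod p) L.h) (Y0 M L x P T (intended (M := M) x P T u))) ρ (fun φ => seed ^ (φ : ℕ))
        (lN.map (Nat.cast : ℕ → ZMod p)) := by
  have hp0 : 0 < p := hp.out.pos
  set z : Fin (KIdx L d) → ZMod p := fun t => ((lN.getD (t : ℕ) 0 : ℕ) : ZMod p) with hzdef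
  have hz : (fun t : Fin (KIdx L d) => (lN.map (Nat.cast : ℕ → ZMod p)).getD (t : ℕ) 0) = z := by
    funext t
    rw [hzdef]
    simp only
    rw [← Nat.cast_zero, List.getD_map]
  have hzl : zlOf M L z = lN := zlOf_cast L rfl lN hlen hlt
  have hlenD := length_descs (M := M) (L := L) (P := P) (T := T) hh x
  -- the reads
  have hreads : (actx p M L x u P T D NB).readsN M lN =
      List.ofFn fun φ : Fin (tableauCSP (F := ZMod p) M L P T x).N =>
        List.ofFn fun j : Fin ((tableauCSP (F := ZMod p) M L P T x).fam φ).arity =>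
          (lde (DigitPoly.nodes (F := ZMod p) L.h) (Y0 M L x P T (intended (M := M) x P T u))
            (readAddr (((tableauCSP (F := ZMod p) M L P T x).fam φ).addr j) z)).val := by
    unfold PCtx.readsN actx
    dsimp only
    apply List.ext_getElem
    · simp [hlenD]
    · intro φ h1 h2
      rw [List.length_ofFn] at h2
      rw [List.getElem_map, List.getElem_ofFn]
      have har := arity_eq (M := M) (L := L) (P := P) (T := T) hh x ⟨φ, h2⟩
      rw [List.getD_eq_getElem _ _ (by rw [hlenD]; exact h2)] at har
      apply List.ext_getElem
      · rw [List.length_map, List.length_ofFn, har]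
      · intro j h3 h4
        rw [List.length_ofFn] at h4
        rw [List.length_map] at h3
        rw [List.getElem_map, List.getElem_ofFn, readAddr_eq_addrN hh x z ⟨φ, h2⟩ ⟨j, h4⟩, hzl]
        dsimp only
        rw [List.getD_eq_getElem _ (0, [], [], []) (by rw [hlenD]; exact h2), List.getD_eq_getElem _ ((0, 0), (0, 0), 0) h3,
          ← cast_YhN L hh hval hT hS, ZMod.val_natCast, Nat.mod_eq_of_lt (YhN_lt M hp0 _ _ _ _ _ _ _ _), ofFn_val_eq_ptN]
        rfl
  have eπ : (actx p M L x u P T D NB).π = ⟨p, L.h, L.kt, L.kJ, x.length, P, T⟩ := rfl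
  have efds : (actx p M L x u P T D NB).fds = descs M x.length P T x := rfl
  unfold PCtx.PhiN Φ Gsum Ψ
  rw [hreads, eπ, efds]
  dsimp only
  rw [natCast_mulM, hz, ← hzl, cast_psiN hh x seed z fun φ j =>
    lde (DigitPoly.nodes (F := ZMod p) L.h) (Y0 M L x P T (intended (M := M) x P T u)) (readAddr (((tableauCSP (F := ZMod p) M L P T x).fam φ).addr j) z),
    hzl, cast_kernelN hh hlen ρ]
  congr 1
  refine prod_congr rfl fun t _ => ?_
  rw [getD_map_cast]

omit hh hval hT hS in
/-- `h ≥ 1` when `|Val| ≤ h`. [folklore] -/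
theorem one_le_h (hval : Nat.card (Val M.tm) ≤ L.h) : 1 ≤ L.h := by
  have := vcode_lt M (noneVal M.tm); omega

/-- **The partial sums with residues are the partial sums of the analysis**: for `NB ≥ hᴷ` and a
residue list `lN` of length `≤ K` with entries `< p`,
`(psumN … lN : ZMod p) = psum_H(Φ, K)(lN)`. [cite: AroraBarakCC2009, §8.3.2] -/
theorem cast_psumN (hNB : L.h ^ KIdx L d ≤ NB) (ρ : Fin (KIdx L d) → ZMod p) (seed : ZMod p) (lN : List ℕ)
    (hlen : lN.length ≤ KIdx L d) (hlt : ∀ a ∈ lN, a < p) :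
    (((actx p M L x u P T D NB).psumN M d (List.ofFn fun t => (ρ t).val) seed.val lN : ℕ) : ZMod p) =
      psum (DigitPoly.nodes (F := ZMod p) L.h)
        (Φ (DigitPoly.nodes (F := ZMod p) L.h) (tableauCSP (F := ZMod p) M L P T x)
          (lde (DigitPoly.nodes (F := ZMod p) L.h) (Y0 M L x P T (intended (M := M) x P T u))) ρ (fun φ => seed ^ (φ : ℕ)))
        (KIdx L d) (lN.map (Nat.cast : ℕ → ZMod p)) := by
  have h1 := one_le_h (M := M) L hval
  rw [psum_eq_sum_digits hh, List.length_map]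
  unfold PCtx.psumN
  rw [show (actx p M L x u P T D NB).π = ⟨p, L.h, L.kt, L.kJ, x.length, P, T⟩ from rfl,
    show (actx p M L x u P T D NB).K = KIdx L d from rfl, show (actx p M L x u P T D NB).NB = NB from rfl]
  dsimp only
  rw [min_eq_left ((Nat.pow_le_pow_right h1 (Nat.sub_le _ _)).trans hNB), natCast_sumM, List.map_map, sum_map_range]
  refine sum_congr rfl fun i _ => ?_
  rw [Function.comp_apply, cast_PhiN L hh hval hT hS ρ seed _ (by simp [constDigits]; omega) fun a ha => ?_, List.map_append]
  rcases List.mem_append.1 ha with ha | ha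
  · exact hlt a ha
  · simp only [constDigits, List.mem_map, List.mem_range] at ha
    obtain ⟨t, -, rfl⟩ := ha
    exact (Nat.mod_lt _ h1).trans_le hh

/-- **The computed coefficients are the coefficients of the honest message.** For `D + 1 ≤ p`,
`NB ≥ hᴷ` and a residue prefix `prefN` of length `< K` with entries `< p`, and ANY proof `hΦ` that
the summand is a polynomial of degree `≤ D` in each coordinate:
`((msgCoeffsN … prefN)[j] : ZMod p) = [Xʲ] roundPoly_H(hΦ)(prefN)`.
[cite: AroraBarakCC2009, §8.3.2] [cite: BabaiFortnowLund1991, §5] -/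
theorem cast_msgCoeffsN (hD : D + 1 ≤ p) (hNB : L.h ^ KIdx L d ≤ NB) (ρ : Fin (KIdx L d) → ZMod p) (seed : ZMod p)
    (hΦ : AxisPoly (Φ (DigitPoly.nodes (F := ZMod p) L.h) (tableauCSP (F := ZMod p) M L P T x)
      (lde (DigitPoly.nodes (F := ZMod p) L.h) (Y0 M L x P T (intended (M := M) x P T u))) ρ (fun φ => seed ^ (φ : ℕ))) (KIdx L d) D)
    (prefN : List ℕ) (hlen : prefN.length < KIdx L d) (hlt : ∀ a ∈ prefN, a < p) (j : ℕ) :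
    ((((actx p M L x u P T D NB).msgCoeffsN M d (List.ofFn fun t => (ρ t).val) seed.val prefN).getD j 0 : ℕ) : ZMod p) =
      (roundPoly (DigitPoly.nodes (F := ZMod p) L.h) hΦ (prefN.map (Nat.cast : ℕ → ZMod p))).coeff j := by
  unfold PCtx.msgCoeffsN
  rw [show (actx p M L x u P T D NB).π = ⟨p, L.h, L.kt, L.kJ, x.length, P, T⟩ from rfl, show (actx p M L x u P T D NB).D = D from rfl]
  dsimp only
  rcases lt_or_ge j (D + 1) with hj | hj
  · rw [List.getD_eq_getElem _ _ (by simpa using hj), List.getElem_map, List.getElem_range, natCast_sumM, List.map_map, sum_map_range,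
      coeff_eq_sum_lagrange hD (natDegree_roundPoly_le _ _) j]
    refine sum_congr rfl fun a ha => ?_
    rw [Function.comp_apply, natCast_mulM, cast_lagrCoeffsN hD (mem_range.1 ha),
      cast_psumN L hh hval hT hS hNB ρ seed _ (by simp; omega) fun b hb => ?_,
      eval_roundPoly hΦ (by simpa using hlen), List.map_append, List.map_cons, List.map_nil]
    rcases List.mem_append.1 hb with hb | hb
    · exact hlt b hb
    · rw [List.mem_singleton.1 hb]; exact (mem_range.1 ha).trans_le hD
  · rw [List.getD_eq_default _ _ (by simpa using hj), Nat.cast_zero, coeff_eq_zero_of_natDegree_lt]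
    exact (natDegree_roundPoly_le _ _).trans_lt (by omega)

end Sem2

/-! ### The programmes -/

section FP

variable (M : TM2ComputableAux Bool Bool) (dd : ℕ)

/-! #### Folds with a list of residues as accumulator -/

/-- A raw list of numerals below `B` is short. [folklore] -/
theorem length_rawE_natE_le_of_lt {L : List ℕ} {B : ℕ} (h : ∀ y ∈ L, y < B) :
    (rawE natE L).length ≤ L.length * (2 * (natE B).length + 2) := by
  rw [length_rawE]
  calc (L.map fun a => 2 * (natE a).length + 2).sum
      ≤ (L.map fun a => 2 * (natE a).length + 2).length • (2 * (natE B).length + 2) :=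
        List.sum_le_card_nsmul _ _ fun x hx => by
          obtain ⟨a, ha, rfl⟩ := List.mem_map.1 hx
          have := length_natE_mono (h a ha).le
          omega
    _ = L.length * (2 * (natE B).length + 2) := by rw [List.length_map, smul_eq_mul]

/-- **A left fold whose accumulator is a list of numbers below a bound read off the context, growing
by at most one item per step**, is polynomial time. [cite: AroraBarakCC2009, §1.3 (polynomially bounded loops)] -/
theorem foldlResList {α σ : Type} {eα : α → List Bool} {eσ : σ → List Bool}
    {step : σ → α → List ℕ → List ℕ} {init : σ → List ℕ} (B : σ → ℕ)
    (hstep : CodeFP (pairE eσ (pairE eα (rawE natE))) (rawE natE) (fun t => step t.1 t.2.1 t.2.2))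
    (hinit : CodeFP eσ (rawE natE) init)
    (hB : ∀ s, (natE (B s)).length ≤ (eσ s).length + 1)
    (hlen : ∀ s a st, (step s a st).length ≤ st.length + 1) (hilen : ∀ s, (init s).length ≤ 1)
    (hsB : ∀ s a st, ∀ y ∈ step s a st, y < B s) (hiB : ∀ s, ∀ y ∈ init s, y < B s) :
    CodeFP (pairE eσ (rawE eα)) (rawE natE) (fun t => t.2.foldl (fun b a => step t.1 a b) (init t.1)) := by
  refine CodeFP.foldl hstep hinit ((X + 1) * (2 * X + 4)) fun s l₁ l₂ => ?_
  have hv : ∀ l : List α, (l.foldl (fun b a => step s a b) (init s)).length ≤ l.length + 1 ∧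
      ∀ y ∈ l.foldl (fun b a => step s a b) (init s), y < B s := by
    intro l
    induction l using List.reverseRecOn with
    | nil => exact ⟨hilen s, hiB s⟩
    | append_singleton l a ih =>
      rw [List.foldl_append, List.foldl_cons, List.foldl_nil, List.length_append, List.length_singleton]
      exact ⟨(hlen s a _).trans (by have := ih.1; omega), hsB s a _⟩
  have h1 := length_rawE_natE_le_of_lt (hv l₁).2
  have h2 : (natE (B s)).length ≤ (eσ s).length + 1 := hB s
  have e2 : (pairE eσ (rawE eα) (s, l₁ ++ l₂)).length = 2 * (eσ s).length + 2 + (rawE eα (l₁ ++ l₂)).length := by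
    rw [pairE_apply, length_boolPair]
  have h6 := length_le_length_rawE eα (l₁ ++ l₂)
  rw [List.length_append] at h6
  have h3 : l₁.length ≤ (pairE eσ (rawE eα) (s, l₁ ++ l₂)).length := by rw [e2]; omega
  have h4 : (eσ s).length ≤ (pairE eσ (rawE eα) (s, l₁ ++ l₂)).length := by rw [e2]; omega
  have h5 := (hv l₁).1
  set N := (pairE eσ (rawE eα) (s, l₁ ++ l₂)).length
  simp only [eval_mul, eval_add, eval_X, eval_one, eval_ofNat]
  calc (rawE natE (l₁.foldl (fun b a => step s a b) (init s))).length
      ≤ (l₁.foldl (fun b a => step s a b) (init s)).length * (2 * (natE (B s)).length + 2) := h1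
    _ ≤ (N + 1) * (2 * N + 4) := Nat.mul_le_mul (by omega) (by omega)

/-! #### The Lagrange coefficient lists -/

/-- `polyMulLinN` off `(q, (cs, b))`. [folklore] -/
theorem polyMulLinC : CodeFP (pairE natE (pairE (rawE natE) natE)) (rawE natE) (fun t => polyMulLinN t.1 t.2.1 t.2.2) := by
  -- context `(q, b)`, items `(u, v)`
  have hI : CodeFP (pairE (pairE natE natE) (pairE natE natE)) natE (fun t => subM t.1.1 t.2.1 (mulM t.1.1 t.1.2 t.2.2)) :=
    modSub (CodeFP.fst _ _).fst' (CodeFP.snd _ _).fst' (modMul (CodeFP.fst _ _).fst' (CodeFP.fst _ _).snd' (CodeFP.snd _ _).snd')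
  have hz := CodeFP.zipWith hI
  have h0 : CodeFP (pairE natE (pairE (rawE natE) natE)) (rawE natE) (fun t => 0 :: t.2.1) :=
    ((rawCons natE).comp ((CodeFP.const _ 0).pair (CodeFP.snd _ _).fst')).congr fun t => rfl
  have h1 : CodeFP (pairE natE (pairE (rawE natE) natE)) (rawE natE) (fun t => t.2.1 ++ [0]) :=
    ((rawAppend natE).comp ((CodeFP.snd _ _).fst'.pair (CodeFP.const _ [0]))).congr fun t => rfl
  exact (hz.comp (((CodeFP.fst _ _).pair (CodeFP.snd _ _).snd').pair (h0.pair h1))).congr fun t => rfl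

/-- Entries of `polyMulLinN` are reduced. [folklore] -/
theorem polyMulLinN_lt {q : ℕ} (hq : 1 ≤ q) (cs : List ℕ) (b : ℕ) : ∀ y ∈ polyMulLinN q cs b, y < q := by
  intro y hy
  unfold polyMulLinN at hy
  rw [List.mem_iff_getElem] at hy
  obtain ⟨i, hi, rfl⟩ := hy
  rw [List.getElem_zipWith]
  exact Nat.mod_lt _ hq

/-- **`lagrNumCoeffsN (max q 1) N a` off `((q, 1ᴺ), a)`.** [folklore] -/
theorem lagrNumCoeffsC : CodeFP (pairE qhE natE) (rawE natE) (fun t => lagrNumCoeffsN (p1 t.1.1) t.1.2 t.2) := by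
  have hlist : CodeFP (pairE qhE natE) (rawE natE) (fun t => (List.range t.1.2).filter (· ≠ t.2)) := by
    have hp : CodeFP (pairE (pairE qhE natE) natE) bitE (fun s => !decide (s.2 = s.1.2)) :=
      (natEq.comp ((CodeFP.snd _ _).pair (CodeFP.fst _ _).snd')).not
    refine ((CodeFP.filter hp).comp ((CodeFP.id _).pair (urange.comp (CodeFP.fst _ _).snd'))).congr fun t => ?_
    dsimp only [Function.comp_apply, id_eq]
    refine List.filter_congr fun b _ => ?_
    simp
  have hstep : CodeFP (pairE (pairE qhE natE) (pairE natE (rawE natE))) (rawE natE) (fun t => polyMulLinN (p1 t.1.1.1) t.2.2 t.2.1) :=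
    polyMulLinC.comp ((p1C.comp (CodeFP.fst _ _).fst'.fst').pair ((CodeFP.snd _ _).snd'.pair (CodeFP.snd _ _).fst'))
  have hinit : CodeFP (pairE qhE natE) (rawE natE) (fun s => [1 % p1 s.1.1]) :=
    (rawSingleton natE).comp (modOf (p1C.comp (CodeFP.fst _ _).fst') (CodeFP.const _ 1))
  have hfold := foldlResList (σ := (ℕ × ℕ) × ℕ) (eσ := pairE qhE natE) (α := ℕ) (eα := natE)
    (step := fun s b cs => polyMulLinN (p1 s.1.1) cs b) (init := fun s => [1 % p1 s.1.1]) (fun s => p1 s.1.1) hstep hinit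
    (fun s => by
      show (natE (p1 s.1.1)).length ≤ (boolPair (boolPair (natE s.1.1) (unE s.1.2)) (natE s.2)).length + 1
      rw [length_boolPair, length_boolPair]; have := length_natE_p1 s.1.1; omega)
    (fun s b cs => by rw [length_polyMulLinN]) (fun s => le_rfl)
    (fun s b cs => polyMulLinN_lt (one_le_p1 _) cs b) (fun s y hy => by
      rw [List.mem_singleton.1 hy]; exact one_mod_lt _ (one_le_p1 _))
  exact (hfold.comp ((CodeFP.id _).pair hlist)).congr fun t => rfl

/-- **`lagrCoeffsN (max q 1) N a` off `((q, 1ᴺ), a)`.** [cite: AroraBarakCC2009, §A.6] -/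
theorem lagrCoeffsC : CodeFP (pairE qhE natE) (rawE natE) (fun t => lagrCoeffsN (p1 t.1.1) t.1.2 t.2) := by
  have hq : CodeFP (pairE qhE natE) natE (fun t => p1 t.1.1) := p1C.comp (CodeFP.fst _ _).fst'
  have hden : CodeFP (pairE qhE natE) natE (fun t => lagrDenM (p1 t.1.1) t.1.2 t.2) :=
    (lagrNumMod.comp ((qhP1 natE).pair ((CodeFP.snd _ _).pair (CodeFP.snd _ _)))).congr fun t => rfl
  have hinv : CodeFP (pairE qhE natE) natE (fun t => invM (p1 t.1.1) (lagrDenM (p1 t.1.1) t.1.2 t.2)) := modInv hq hden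
  have hI : CodeFP (pairE (pairE qhE natE) natE) natE (fun s => mulM (p1 s.1.1.1) (invM (p1 s.1.1.1) (lagrDenM (p1 s.1.1.1) s.1.1.2 s.1.2)) s.2) :=
    modMul (hq.comp (CodeFP.fst _ _)) (hinv.comp (CodeFP.fst _ _)) (CodeFP.snd _ _)
  exact ((CodeFP.map hI).comp ((CodeFP.id _).pair lagrNumCoeffsC)).congr fun t => rfl

/-! #### The context record -/

/-- The context as a tuple. [folklore] -/
def PCtx.tup (c : PCtx) : Prm × ℕ × ℕ × ℕ × ℕ × ℕ × List Bool × List Bool × List FamDesc :=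
  (c.π, c.K, c.D, c.TB, c.SB, c.NB, c.x, c.u, c.fds)

/-- Code of the context tuple: `K`, `D`, `TB`, `SB`, `NB` in unary. [folklore] -/
abbrev ptupE : Prm × ℕ × ℕ × ℕ × ℕ × ℕ × List Bool × List Bool × List FamDesc → List Bool :=
  pairE prmE (pairE unE (pairE unE (pairE unE (pairE unE (pairE unE (pairE strE (pairE strE (rawE fdE))))))))

/-- **Code of the prover's context.** [folklore] -/
def pcE : PCtx → List Bool := fun c => ptupE c.tup

/-- The context as its tuple is free. [folklore] -/
theorem ptupC : CodeFP pcE ptupE PCtx.tup := CodeFP.transparent fun _ => rfl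

/-- `π`. [folklore] -/
theorem pcπC : CodeFP pcE prmE PCtx.π := (CodeFP.fst _ _).comp ptupC
/-- `K`. [folklore] -/
theorem pcKC : CodeFP pcE unE PCtx.K := (CodeFP.snd _ _).fst'.comp ptupC
/-- `D`. [folklore] -/
theorem pcDC : CodeFP pcE unE PCtx.D := (CodeFP.snd _ _).snd'.fst'.comp ptupC
/-- `TB`. [folklore] -/
theorem pcTBC : CodeFP pcE unE PCtx.TB := (CodeFP.snd _ _).snd'.snd'.fst'.comp ptupC
/-- `SB`. [folklore] -/
theorem pcSBC : CodeFP pcE unE PCtx.SB := (CodeFP.snd _ _).snd'.snd'.snd'.fst'.comp ptupC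
/-- `NB`. [folklore] -/
theorem pcNBC : CodeFP pcE unE PCtx.NB := (CodeFP.snd _ _).snd'.snd'.snd'.snd'.fst'.comp ptupC
/-- `x`. [folklore] -/
theorem pcxC : CodeFP pcE strE PCtx.x := (CodeFP.snd _ _).snd'.snd'.snd'.snd'.snd'.fst'.comp ptupC
/-- `u`. [folklore] -/
theorem pcuC : CodeFP pcE strE PCtx.u := (CodeFP.snd _ _).snd'.snd'.snd'.snd'.snd'.snd'.fst'.comp ptupC
/-- `fds`. [folklore] -/
theorem pcfdsC : CodeFP pcE (rawE fdE) PCtx.fds := (CodeFP.snd _ _).snd'.snd'.snd'.snd'.snd'.snd'.snd'.comp ptupC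

/-- **The normalized context**: the modulus replaced by the working modulus `max q 1`. [folklore] -/
def PCtx.nrm (c : PCtx) : PCtx := { c with π := { c.π with q := p1 c.π.q } }

/-- `(max q 1, 1ʰ)` off the context. [folklore] -/
theorem pcqhC : CodeFP pcE qhE (fun c => (p1 c.π.q, c.π.h)) := qhC.comp pcπC

/-! #### Reads, kernel, summand -/

/-- `ptN` off `(q, (1ᵐ, al))`. [folklore] -/
theorem ptNC : CodeFP (pairE natE (pairE unE (rawE natE))) (rawE natE) (fun t => ptN t.1 t.2.1 t.2.2) := by
  have hI : CodeFP (pairE (pairE natE (pairE unE (rawE natE))) natE) natE (fun s => s.1.2.2.getD s.2 0 % s.1.1) :=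
    natMod.comp (((rawGetD natE natE_zero).comp ((CodeFP.fst _ _).snd'.snd'.pair (CodeFP.snd _ _))).pair (CodeFP.fst _ _).fst')
  exact ((CodeFP.map hI).comp ((CodeFP.id _).pair (urange.comp (CodeFP.snd _ _).fst'))).congr fun t => rfl

/-- **The oracle values at the read addresses** off `(c, zl)` (normalized context). [cite: BabaiFortnowLund1991, §5] -/
theorem readsNC : CodeFP (pairE pcE (rawE natE)) (rawE (rawE natE)) (fun t => (t.1.nrm).readsN M t.2) := by
  -- context `t = (c, zl)`, family `fd`, read `rd`
  have hc : CodeFP (pairE (pairE (pairE pcE (rawE natE)) fdE) rdE) pcE (fun s => s.1.1.1) := (CodeFP.fst _ _).fst'.fst'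
  have hπ : CodeFP (pairE (pairE (pairE pcE (rawE natE)) fdE) rdE) prmE (fun s => s.1.1.1.π) := pcπC.comp hc
  have haddr : CodeFP (pairE (pairE (pairE pcE (rawE natE)) fdE) rdE) (rawE natE)
      (fun s => addrN s.1.1.1.π.h s.1.1.1.π.kt s.1.1.1.π.kJ s.1.1.2 s.2) :=
    addrNC.comp (((hC.comp hπ).pair ((ktC.comp hπ).pair (kJC.comp hπ))).pair ((CodeFP.fst _ _).fst'.snd'.pair (CodeFP.snd _ _)))
  have hm : CodeFP (pairE (pairE (pairE pcE (rawE natE)) fdE) rdE) unE (fun s => s.1.1.1.π.kt + s.1.1.1.π.kJ + 1) :=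
    unSucc.comp (unAdd.comp ((ktC.comp hπ).pair (kJC.comp hπ)))
  have hpt : CodeFP (pairE (pairE (pairE pcE (rawE natE)) fdE) rdE) (rawE natE)
      (fun s => ptN (p1 s.1.1.1.π.q) (s.1.1.1.π.kt + s.1.1.1.π.kJ + 1) (addrN s.1.1.1.π.h s.1.1.1.π.kt s.1.1.1.π.kJ s.1.1.2 s.2)) :=
    ptNC.comp ((p1C.comp (qC.comp hπ)).pair (hm.pair haddr))
  have hY : CodeFP (pairE (pairE (pairE pcE (rawE natE)) fdE) rdE) natE
      (fun s => YhN M (p1 s.1.1.1.π.q) s.1.1.1.π.h s.1.1.1.π.kt s.1.1.1.π.kJ s.1.1.1.x s.1.1.1.u s.1.1.1.TB s.1.1.1.SB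
        (ptN (p1 s.1.1.1.π.q) (s.1.1.1.π.kt + s.1.1.1.π.kJ + 1) (addrN s.1.1.1.π.h s.1.1.1.π.kt s.1.1.1.π.kJ s.1.1.2 s.2))) :=
    (YhNC M).comp ((((p1C.comp (qC.comp hπ)).pair (hC.comp hπ)).pair ((ktC.comp hπ).pair (kJC.comp hπ))).pair
      (((pcxC.comp hc).pair (pcuC.comp hc)).pair ((pcTBC.comp hc).pair ((pcSBC.comp hc).pair hpt))))
  have hF : CodeFP (pairE (pairE pcE (rawE natE)) fdE) (rawE natE) (fun s => s.2.2.1.map fun rd =>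
      YhN M (p1 s.1.1.π.q) s.1.1.π.h s.1.1.π.kt s.1.1.π.kJ s.1.1.x s.1.1.u s.1.1.TB s.1.1.SB
        (ptN (p1 s.1.1.π.q) (s.1.1.π.kt + s.1.1.π.kJ + 1) (addrN s.1.1.π.h s.1.1.π.kt s.1.1.π.kJ s.1.2 rd))) :=
    ((CodeFP.map hY).comp ((CodeFP.id _).pair (CodeFP.snd _ _).snd'.fst')).congr fun s => rfl
  exact ((CodeFP.map hF).comp ((CodeFP.id _).pair (pcfdsC.comp (CodeFP.fst _ _)))).congr fun t => rfl

/-- **The kernel** off `((q, 1ʰ), (zl, ρl))`. [cite: BFLS1991, §5] -/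
theorem kernelNC : CodeFP (pairE qhE (pairE (rawE natE) (rawE natE))) natE (fun t => kernelN t.1.1 t.1.2 t.2.1 t.2.2) := by
  have hI : CodeFP (pairE (pairE qhE (pairE (rawE natE) (rawE natE))) (pairE natE natE)) natE (fun s => eqPolyM s.1.1.1 s.1.1.2 s.2.1 s.2.2) :=
    eqPolyMod.comp ((CodeFP.fst _ _).fst'.pair (CodeFP.snd _ _))
  exact (modProd (CodeFP.fst _ _).fst' ((CodeFP.map hI).comp ((CodeFP.id _).pair ((rawZip natE natE).comp (CodeFP.snd _ _))))).congr
    fun t => rfl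

/-- **The sumcheck summand** off `(c, (ρl, (seed, zl)))` (normalized context). [cite: BFLS1991, §5] -/
theorem PhiNC : CodeFP (pairE pcE (pairE (rawE natE) (pairE natE (rawE natE)))) natE
    (fun t => (t.1.nrm).PhiN M dd t.2.1 t.2.2.1 t.2.2.2) := by
  have hc : CodeFP (pairE pcE (pairE (rawE natE) (pairE natE (rawE natE)))) pcE (fun t => t.1) := CodeFP.fst _ _
  have hzl : CodeFP (pairE pcE (pairE (rawE natE) (pairE natE (rawE natE)))) (rawE natE) (fun t => t.2.2.2) := (CodeFP.snd _ _).snd'.snd'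
  have hreads : CodeFP (pairE pcE (pairE (rawE natE) (pairE natE (rawE natE)))) (rawE (rawE natE)) (fun t => (t.1.nrm).readsN M t.2.2.2) :=
    (readsNC M).comp (hc.pair hzl)
  have hpsi : CodeFP (pairE pcE (pairE (rawE natE) (pairE natE (rawE natE)))) natE
      (fun t => psiN (p1 t.1.π.q) t.1.π.h t.1.π.kt t.1.π.kJ dd t.1.π.n t.1.π.P t.1.π.T t.2.2.1 t.2.2.2 ((t.1.nrm).readsN M t.2.2.2) t.1.fds) :=
    (psiNC dd).comp ((pcπC.comp hc).pair ((CodeFP.snd _ _).snd'.fst'.pair (hzl.pair (hreads.pair (pcfdsC.comp hc)))))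
  have hker : CodeFP (pairE pcE (pairE (rawE natE) (pairE natE (rawE natE)))) natE (fun t => kernelN (p1 t.1.π.q) t.1.π.h t.2.2.2 t.2.1) :=
    kernelNC.comp ((pcqhC.comp hc).pair (hzl.pair (CodeFP.snd _ _).fst'))
  exact (modMul (p1C.comp (qC.comp (pcπC.comp hc))) hpsi hker).congr fun t => rfl

/-- **The partial sums** off `(c, (ρl, (seed, l)))` (normalized context, budget `NB`).
[cite: AroraBarakCC2009, §8.3.2] -/
theorem psumNC : CodeFP (pairE pcE (pairE (rawE natE) (pairE natE (rawE natE)))) natE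
    (fun t => (t.1.nrm).psumN M dd t.2.1 t.2.2.1 t.2.2.2) := by
  have hc : CodeFP (pairE pcE (pairE (rawE natE) (pairE natE (rawE natE)))) pcE (fun t => t.1) := CodeFP.fst _ _
  have hl : CodeFP (pairE pcE (pairE (rawE natE) (pairE natE (rawE natE)))) (rawE natE) (fun t => t.2.2.2) := (CodeFP.snd _ _).snd'.snd'
  -- `k = K - |l|` in unary, the enumeration list `range (min (h^k) NB)`
  have hk : CodeFP (pairE pcE (pairE (rawE natE) (pairE natE (rawE natE)))) unE (fun t => t.1.K - t.2.2.2.length) :=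
    (unSubLen natE).comp ((pcKC.comp hc).pair hl)
  have hL : CodeFP (pairE pcE (pairE (rawE natE) (pairE natE (rawE natE)))) (rawE natE)
      (fun t => List.range (min (t.1.π.h ^ (t.1.K - t.2.2.2.length)) t.1.NB)) :=
    urange.comp (unOfNatMin.comp ((pcNBC.comp hc).pair (natPow.comp ((natOfUn.comp (hC.comp (pcπC.comp hc))).pair hk))))
  -- item `i ↦ PhiN (l ++ digits i)`
  have hI : CodeFP (pairE (pairE pcE (pairE (rawE natE) (pairE natE (rawE natE)))) natE) natE
      (fun s => (s.1.1.nrm).PhiN M dd s.1.2.1 s.1.2.2.1 (s.1.2.2.2 ++ constDigits s.1.1.π.h (s.1.1.K - s.1.2.2.2.length) s.2)) := by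
    have hdig : CodeFP (pairE (pairE pcE (pairE (rawE natE) (pairE natE (rawE natE)))) natE) (rawE natE)
        (fun s => constDigits s.1.1.π.h (s.1.1.K - s.1.2.2.2.length) s.2) :=
      constDigitsC.comp ((hC.comp (pcπC.comp (hc.comp (CodeFP.fst _ _)))).pair ((hk.comp (CodeFP.fst _ _)).pair (CodeFP.snd _ _)))
    exact ((PhiNC M dd).comp ((hc.comp (CodeFP.fst _ _)).pair (((CodeFP.snd _ _).fst'.comp (CodeFP.fst _ _)).pair
      (((CodeFP.snd _ _).snd'.fst'.comp (CodeFP.fst _ _)).pair ((rawAppend natE).comp ((hl.comp (CodeFP.fst _ _)).pair hdig)))))).congr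
      fun s => rfl
  exact (modSum (p1C.comp (qC.comp (pcπC.comp hc))) ((CodeFP.map hI).comp ((CodeFP.id _).pair hL))).congr fun t => rfl

/-- **The coefficients of the honest message** off `(c, (ρl, (seed, pref)))` (normalized context).
[cite: AroraBarakCC2009, §8.3.2] [cite: BabaiFortnowLund1991, §5] -/
theorem msgCoeffsC : CodeFP (pairE pcE (pairE (rawE natE) (pairE natE (rawE natE)))) (rawE natE)
    (fun t => (t.1.nrm).msgCoeffsN M dd t.2.1 t.2.2.1 t.2.2.2) := by
  have hc : CodeFP (pairE pcE (pairE (rawE natE) (pairE natE (rawE natE)))) pcE (fun t => t.1) := CodeFP.fst _ _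
  have hD1 : CodeFP (pairE pcE (pairE (rawE natE) (pairE natE (rawE natE)))) unE (fun t => t.1.D + 1) := unSucc.comp (pcDC.comp hc)
  -- item `(j, a) ↦ psumN (pref ++ [a]) · [Xʲ] L_a`; context `(t, j)`, inner item `a`
  have hIa : CodeFP (pairE (pairE (pairE pcE (pairE (rawE natE) (pairE natE (rawE natE)))) natE) natE) natE
      (fun s => mulM (p1 s.1.1.1.π.q) ((s.1.1.1.nrm).psumN M dd s.1.1.2.1 s.1.1.2.2.1 (s.1.1.2.2.2 ++ [s.2]))
        ((lagrCoeffsN (p1 s.1.1.1.π.q) (s.1.1.1.D + 1) s.2).getD s.1.2 0)) := by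
    have ht : CodeFP (pairE (pairE (pairE pcE (pairE (rawE natE) (pairE natE (rawE natE)))) natE) natE)
        (pairE pcE (pairE (rawE natE) (pairE natE (rawE natE)))) (fun s => s.1.1) := (CodeFP.fst _ _).fst'
    have hps : CodeFP (pairE (pairE (pairE pcE (pairE (rawE natE) (pairE natE (rawE natE)))) natE) natE) natE
        (fun s => (s.1.1.1.nrm).psumN M dd s.1.1.2.1 s.1.1.2.2.1 (s.1.1.2.2.2 ++ [s.2])) :=
      ((psumNC M dd).comp ((hc.comp ht).pair (((CodeFP.snd _ _).fst'.comp ht).pair (((CodeFP.snd _ _).snd'.fst'.comp ht).pair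
        ((rawAppend natE).comp ((((CodeFP.snd _ _).snd'.snd'.comp ht)).pair ((rawSingleton natE).comp (CodeFP.snd _ _)))))))).congr
        fun s => rfl
    have hlc : CodeFP (pairE (pairE (pairE pcE (pairE (rawE natE) (pairE natE (rawE natE)))) natE) natE) (rawE natE)
        (fun s => lagrCoeffsN (p1 s.1.1.1.π.q) (s.1.1.1.D + 1) s.2) :=
      lagrCoeffsC.comp ((((qC.comp (pcπC.comp (hc.comp ht))).pair (hD1.comp ht))).pair (CodeFP.snd _ _))
    have hget : CodeFP (pairE (pairE (pairE pcE (pairE (rawE natE) (pairE natE (rawE natE)))) natE) natE) natE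
        (fun s => (lagrCoeffsN (p1 s.1.1.1.π.q) (s.1.1.1.D + 1) s.2).getD s.1.2 0) :=
      (rawGetD natE natE_zero).comp (hlc.pair (CodeFP.fst _ _).snd')
    exact (modMul (p1C.comp (qC.comp (pcπC.comp (hc.comp ht)))) hps hget).congr fun s => rfl
  have hIj : CodeFP (pairE (pairE pcE (pairE (rawE natE) (pairE natE (rawE natE)))) natE) natE
      (fun s => sumM (p1 s.1.1.π.q) ((List.range (s.1.1.D + 1)).map fun a =>
        mulM (p1 s.1.1.π.q) ((s.1.1.nrm).psumN M dd s.1.2.1 s.1.2.2.1 (s.1.2.2.2 ++ [a]))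
          ((lagrCoeffsN (p1 s.1.1.π.q) (s.1.1.D + 1) a).getD s.2 0))) :=
    (modSum (p1C.comp (qC.comp (pcπC.comp (hc.comp (CodeFP.fst _ _))))) ((CodeFP.map hIa).comp ((CodeFP.id _).pair
      (urange.comp (hD1.comp (CodeFP.fst _ _)))))).congr fun s => rfl
  exact ((CodeFP.map hIj).comp ((CodeFP.id _).pair (urange.comp hD1))).congr fun t => rfl

end FP

end TabEval

end Literature.Computability.Complexity

end
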